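import Literature.AlgebraicGeometry.Motives.SymmetricPowerSplitDivisors
import Literature.AlgebraicGeometry.Motives.JacobianGaloisDescent
import HarnessLib

/-!
# `C^{(d)}` classifies divisors split over a Galois extension: Galois descent of the tuple point
# (Milne, *Jacobian Varieties*, Thm. 3.13 at field-valued points, separable case; Weil–Lang)

Milne proves Thm. 3.13 (`C^{(r)}` represents `Div^r_C`) by splitting the divisor after a finite
flat covering and descending the classifying map of the split divisor
`T' → Cʳ → C^{(r)}`. This file carries that out at field-valued points `T = Spec F` when the
splitting field `F'/F` is finite GALOIS — the case Lang calls "obvious" (*Abelian Varieties*, I §1,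
p. 8: Weil's fundamental theorem on symmetric functions "is obvious in the case where all the points
of `𝔞` are rational over a separable extension of `k`"); the inseparable case (norms) remains the
open input of the construction of the Jacobian in positive characteristic.

* §3 `exists_fieldPoint_of_gal_invariant` — **Galois descent of invariant field-valued points of
  `C^{(d)}`**: an `F'`-valued point `y : Spec F' → C^{(d)}` over `k` with
  `Spec(σ⁻¹) ≫ y = y` for all `σ ∈ Gal(F'/F)` is the restriction of an `F`-valued point. The proof
  is the tree's Galois descent of morphisms (`GaloisDescent.descentScheme`,
  `Motives/JacobianGaloisDescent`, Görtz–Wedhorn I Thm. 14.72 (1): `EffectiveEpi.desc` along the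
  flat covering, the cocycle condition checked on the reduced kernel pair) applied to the
  `F`-schemes `Spec F` (`XF`) and `C^{(d)} ×_k Spec F` (`YF`) with the descent datum
  `descentDatum` built from `y` (`gal_descentDatum`: equivariance = invariance of `y`);
  `descendedMap`, `descendedMap_comp_hom`, `bcSpec_descendedMap`.
* §3b **`exists_fieldPoint_of_split_galois`** — if the pullback of a Cartier divisor `D` on `C_F`
  to `C_{F'}` is `Σᵢ [Qᵢ]` for `F'`-valued points `Qᵢ` of `C`, then the image of `(Q₁, …, Q_d)` in
  `C^{(d)}(F')` is the restriction along `extHom : Spec F' → Spec F` of an `F`-valued point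
  `w : Spec F → C^{(d)}`: by `exists_perm_of_split` (`Motives/SymmetricPowerSplitDivisors`) each
  `Spec σ⁻¹` permutes the `Qᵢ`, so the tuple point is invariant (`comp_tuplePt_mk_eq`), and §3
  applies. (`extPt`, `extHom`, `specAutIso`, `galPt` are the field point of `F'`, the morphism to
  the field point of `F`, and the Galois automorphisms as `k`-isomorphisms.)

Everything is proved; no named facts (D-0026). Part of the construction of the Jacobian
(`nonempty_jacobian_of_isSmoothProjective`): the classifying points needed for the Weil–Lang normal
law of composition on `C^{(g)}` (Lang, *Abelian Varieties*, II §2) exist whenever the divisors in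
question split separably.

## References

* J. S. Milne, *Jacobian Varieties*, in: Arithmetic Geometry (Cornell–Silverman, eds.), Springer
  1986, §3 Thm. 3.13 with its proof (pp. 246–247 of the volume). [Milne1986JacobianVarieties]
* U. Görtz, T. Wedhorn, *Algebraic Geometry I*, 2nd ed. (2020), Thm. 14.72 (1). [GortzWedhorn2020]
* S. Lang, *Abelian Varieties* (1959/1983), Ch. I §1, p. 8. [LangAbelianVarieties]
-/

noncomputable section

open CategoryTheory CategoryTheory.Limits AlgebraicGeometry IsLocalRing
  MonoidalCategory CartesianMonoidalCategory

universe u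

namespace Literature.AlgebraicGeometry.Motives

open Literature.AlgebraicGeometry.RelativeSpec CurvePlaces FieldPoint CartierDivisor RatFn

/-! ### §3 Galois descent of an invariant field-valued point of `C^{(d)}` -/

section Descent

set_option backward.isDefEq.respectTransparency false

open AbelianVariety (bcSpec specAut specAut_mul specAut_one specAut_comp_bcSpec specAut_comp_bcSpec_assoc)
open GaloisDescent

variable {k : Type u} [Field k] (C : SchemeOver k) (hC : IsProjectiveOver C) (d : ℕ)
  (F F' : Type u) [Field F] [Field F'] [Algebra F F'] (π : Spec (.of F) ⟶ Spec (.of k))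

/-- `Spec F` as an `F`-scheme. [folklore] -/
abbrev XF : SchemeOver F := Over.mk (𝟙 (Spec (.of F)))

/-- `C^{(d)} ×_k Spec F` as an `F`-scheme. [folklore] -/
abbrev YF : SchemeOver F := Over.mk (pullback.snd (symPowProj C hC d).hom π)

/-- The base change `Spec F ×_F Spec F'` of `Spec F` is reduced. [folklore] -/
instance isReduced_bc_XF : IsReduced (bc F' (XF F)) := by
  change IsReduced (pullback (𝟙 (Spec (.of F))) (bcSpec F F'))
  haveI : IsIso (pullback.snd (𝟙 (Spec (.of F))) (bcSpec F F')) := pullback_snd_iso_of_left_iso _ _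
  exact isReduced_of_isOpenImmersion (pullback.snd (𝟙 (Spec (.of F))) (bcSpec F F'))

/-- `Spec F → Spec F` is locally of finite type. [folklore] -/
instance locallyOfFiniteType_XF_hom : LocallyOfFiniteType (XF F).hom := by
  change LocallyOfFiniteType (𝟙 _)
  infer_instance

/-- `C^{(d)}_F → Spec F` is separated. [folklore] -/
instance isSeparated_YF_hom : IsSeparated (YF C hC d F π).hom := by
  change IsSeparated (pullback.snd (symPowProj C hC d).hom π)
  infer_instance

variable (yl : Spec (.of F') ⟶ (symPowProj C hC d).left)
  (hyl : yl ≫ (symPowProj C hC d).hom = bcSpec F F' ≫ π)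

/-- The descent datum: the `F'`-point `y` of `C^{(d)}` as a morphism
`Spec F ×_F Spec F' → (C^{(d)} ×_k Spec F) ×_F Spec F'`. [folklore] -/
def descentDatum : bc F' (XF F) ⟶ bc F' (YF C hC d F π) :=
  pullback.lift
    (pullback.lift (pullback.snd (XF F).hom (bcSpec F F') ≫ yl)
      (pullback.snd (XF F).hom (bcSpec F F') ≫ bcSpec F F')
      (by rw [Category.assoc, Category.assoc, hyl]))
    (pullback.snd (XF F).hom (bcSpec F F'))
    (pullback.lift_snd _ _ _)

/-- The descent datum lies over `Spec F'`. [folklore] -/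
@[reassoc]
theorem descentDatum_snd :
    descentDatum C hC d F F' π yl hyl ≫ pullback.snd (YF C hC d F π).hom (bcSpec F F') =
      pullback.snd (XF F).hom (bcSpec F F') :=
  pullback.lift_snd _ _ _

/-- First coordinate of the descent datum: `pr₂ ≫ y`. [folklore] -/
theorem descentDatum_fst_fst :
    descentDatum C hC d F F' π yl hyl ≫ pullback.fst (YF C hC d F π).hom (bcSpec F F') ≫
        pullback.fst (symPowProj C hC d).hom π = pullback.snd (XF F).hom (bcSpec F F') ≫ yl := by
  rw [descentDatum, pullback.lift_fst_assoc, pullback.lift_fst]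

/-- Second coordinate of the descent datum: `pr₂ ≫ (Spec F' → Spec F)`. [folklore] -/
theorem descentDatum_fst_snd :
    descentDatum C hC d F F' π yl hyl ≫ pullback.fst (YF C hC d F π).hom (bcSpec F F') ≫
        pullback.snd (symPowProj C hC d).hom π = pullback.snd (XF F).hom (bcSpec F F') ≫ bcSpec F F' := by
  rw [descentDatum, pullback.lift_fst_assoc, pullback.lift_snd]

/-- **The descent datum is Galois-equivariant** when `y` is invariant under the automorphisms
`Spec σ⁻¹` of `Spec F'`. [folklore] -/
theorem gal_descentDatum (hinv : ∀ σ : F' ≃ₐ[F] F', specAut F' σ⁻¹ ≫ yl = yl) (σ : F' ≃ₐ[F] F') :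
    gal F' (XF F) σ ≫ descentDatum C hC d F F' π yl hyl =
      descentDatum C hC d F F' π yl hyl ≫ gal F' (YF C hC d F π) σ := by
  apply pullback.hom_ext
  · rw [Category.assoc, Category.assoc, gal_fst]
    apply pullback.hom_ext
    · rw [Category.assoc, Category.assoc, descentDatum_fst_fst, gal_snd_assoc, hinv]
    · rw [Category.assoc, Category.assoc, descentDatum_fst_snd, gal_snd_assoc, specAut_comp_bcSpec]
  · rw [Category.assoc, Category.assoc, descentDatum_snd, gal_snd, gal_snd, descentDatum_snd_assoc]

variable [FiniteDimensional F F'] [IsGalois F F'] (hinv : ∀ σ : F' ≃ₐ[F] F', specAut F' σ⁻¹ ≫ yl = yl)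

/-- The descended morphism `Spec F → C^{(d)} ×_k Spec F`. [folklore] -/
def descendedLeft : Spec (.of F) ⟶ (YF C hC d F π).left :=
  descentScheme F' (X := XF F) (Y := YF C hC d F π) (descentDatum C hC d F F' π yl hyl)
    (descentDatum_snd C hC d F F' π yl hyl) (gal_descentDatum C hC d F F' π yl hyl hinv)

/-- The defining property of the descended morphism. [folklore] -/
theorem fst_descendedLeft :
    pullback.fst (XF F).hom (bcSpec F F') ≫ descendedLeft C hC d F F' π yl hyl hinv =
      descentDatum C hC d F F' π yl hyl ≫ pullback.fst (YF C hC d F π).hom (bcSpec F F') :=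
  fst_descentScheme F' (X := XF F) (Y := YF C hC d F π) _ _ _

/-- The descended morphism `Spec F → C^{(d)}`. [folklore] -/
def descendedMap : Spec (.of F) ⟶ (symPowProj C hC d).left :=
  descendedLeft C hC d F F' π yl hyl hinv ≫ pullback.fst (symPowProj C hC d).hom π

/-- The descended morphism lies over `π : Spec F → Spec k`. [folklore] -/
theorem descendedMap_comp_hom :
    descendedMap C hC d F F' π yl hyl hinv ≫ (symPowProj C hC d).hom = π := by
  set f := pullback.fst (XF F).hom (bcSpec F F') with hf
  haveI : Epi f := inferInstance
  -- `f ≫ descendedLeft ≫ pr₁ ≫ (structure map) = f ≫ π`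
  have hP : pullback.snd (XF F).hom (bcSpec F F') ≫ bcSpec F F' = f := by
    rw [← pullback.condition]
    exact Category.comp_id _
  have key : f ≫ descendedLeft C hC d F F' π yl hyl hinv ≫ pullback.fst (symPowProj C hC d).hom π ≫
      (symPowProj C hC d).hom = f ≫ π := by
    rw [(reassoc_of% fst_descendedLeft C hC d F F' π yl hyl hinv), pullback.condition,
      (reassoc_of% descentDatum_fst_snd C hC d F F' π yl hyl), ← Category.assoc, hP]
  have key2 : f ≫ (descendedMap C hC d F F' π yl hyl hinv ≫ (symPowProj C hC d).hom) = f ≫ π :=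
    (congrArg (f ≫ ·) (Category.assoc _ _ _)).trans key
  exact (cancel_epi f).1 key2

/-- **The descended morphism restricts to `y` over `F'`.** [cite: GortzWedhorn2020, Thm. 14.72 (1)] -/
theorem bcSpec_descendedMap : bcSpec F F' ≫ descendedMap C hC d F F' π yl hyl hinv = yl := by
  -- the section `Spec F' → Spec F ×_F Spec F'`
  set e : Spec (.of F') ⟶ bc F' (XF F) := pullback.lift (bcSpec F F') (𝟙 _)
    ((Category.comp_id _).trans (Category.id_comp _).symm) with he
  have he1 : e ≫ pullback.fst (XF F).hom (bcSpec F F') = bcSpec F F' := pullback.lift_fst _ _ _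
  have he2 : e ≫ pullback.snd (XF F).hom (bcSpec F F') = 𝟙 _ := pullback.lift_snd _ _ _
  calc bcSpec F F' ≫ descendedMap C hC d F F' π yl hyl hinv
      = (e ≫ pullback.fst (XF F).hom (bcSpec F F')) ≫ descendedMap C hC d F F' π yl hyl hinv := by
        rw [he1]
    _ = e ≫ pullback.fst (XF F).hom (bcSpec F F') ≫
          descendedLeft C hC d F F' π yl hyl hinv ≫ pullback.fst (symPowProj C hC d).hom π :=
        Category.assoc _ _ _
    _ = e ≫ descentDatum C hC d F F' π yl hyl ≫ pullback.fst (YF C hC d F π).hom (bcSpec F F') ≫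
          pullback.fst (symPowProj C hC d).hom π :=
        congrArg (e ≫ ·) ((reassoc_of% fst_descendedLeft C hC d F F' π yl hyl hinv) _)
    _ = e ≫ pullback.snd (XF F).hom (bcSpec F F') ≫ yl :=
        congrArg (e ≫ ·) (descentDatum_fst_fst C hC d F F' π yl hyl)
    _ = (e ≫ pullback.snd (XF F).hom (bcSpec F F')) ≫ yl := (Category.assoc _ _ _).symm
    _ = yl := by rw [he2, Category.id_comp]

include hyl hinv in
/-- **Galois descent of invariant field-valued points of `C^{(d)}`** (Görtz–Wedhorn I,
Thm. 14.72 (1), descent of morphisms along `Spec F' → Spec F`): an `F'`-valued point of `C^{(d)}`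
over `k` (`F'/F` finite Galois) which is invariant under the automorphisms `Spec σ⁻¹`,
`σ ∈ Gal(F'/F)`, is the restriction of an `F`-valued point. [cite: GortzWedhorn2020, Thm. 14.72 (1)] -/
theorem exists_fieldPoint_of_gal_invariant :
    ∃ w : Over.mk π ⟶ symPowProj C hC d, bcSpec F F' ≫ w.left = yl :=
  ⟨Over.homMk (descendedMap C hC d F F' π yl hyl hinv) (descendedMap_comp_hom C hC d F F' π yl hyl hinv),
    bcSpec_descendedMap C hC d F F' π yl hyl hinv⟩

end Descent

/-! ### §3b The classifying point of a separably split divisor -/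

section SplitGalois

set_option backward.isDefEq.respectTransparency false

open AbelianVariety (bcSpec specAut specAut_mul specAut_one specAut_comp_bcSpec specAut_comp_bcSpec_assoc)

variable {k : Type u} [Field k] (C : SchemeOver k) [IsIntegral C.left] [SmoothOfRelativeDimension 1 C.hom]
  [IsProper C.hom] [GeometricallyIntegral C.hom] (hC : IsProjectiveOver C) (d : ℕ)
  (F F' : Type u) [Field F] [Field F'] [Algebra F F'] (π : Spec (.of F) ⟶ Spec (.of k))

/-- The field point `Spec F' → Spec F → Spec k` of an extension `F'/F`. [folklore] -/
abbrev extPt : Spec (.of F') ⟶ Spec (.of k) := bcSpec F F' ≫ π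

/-- `Spec F' → Spec F` as a morphism of field points over `k`. [folklore] -/
def extHom : Over.mk (extPt F F' π) ⟶ Over.mk π := Over.homMk (bcSpec F F') rfl

omit [IsIntegral C.left] [SmoothOfRelativeDimension 1 C.hom] [IsProper C.hom] [GeometricallyIntegral C.hom] in
/-- The underlying morphism of `extHom` is `Spec F' → Spec F`. [folklore] -/
@[simp] theorem extHom_left : (extHom F F' π).left = bcSpec F F' := rfl

/-- `Spec σ` as an automorphism of `Spec F'` (inverse `Spec σ⁻¹`). [folklore] -/
def specAutIso (σ : F' ≃ₐ[F] F') : Spec (.of F') ≅ Spec (.of F') where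
  hom := specAut F' σ
  inv := specAut F' σ⁻¹
  hom_inv_id := by rw [← specAut_mul, mul_inv_cancel, specAut_one]
  inv_hom_id := by rw [← specAut_mul, inv_mul_cancel, specAut_one]

/-- The Galois automorphism `Spec σ⁻¹` of the field point `Spec F'`, over `Spec F`. [folklore] -/
def galPt (σ : F' ≃ₐ[F] F') : Over.mk (extPt F F' π) ≅ Over.mk (extPt F F' π) :=
  Over.isoMk (specAutIso F F' σ⁻¹) (by
    change specAut F' σ⁻¹ ≫ bcSpec F F' ≫ π = bcSpec F F' ≫ π
    rw [specAut_comp_bcSpec_assoc])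

omit [IsIntegral C.left] [SmoothOfRelativeDimension 1 C.hom] [IsProper C.hom] [GeometricallyIntegral C.hom] in
/-- The underlying morphism of `galPt σ` is `Spec σ⁻¹`. [folklore] -/
@[simp] theorem galPt_hom_left (σ : F' ≃ₐ[F] F') : (galPt F F' π σ).hom.left = specAut F' σ⁻¹ :=
  Over.isoMk_hom_left _ _

omit [IsIntegral C.left] [SmoothOfRelativeDimension 1 C.hom] [IsProper C.hom] [GeometricallyIntegral C.hom] in
/-- `galPt σ` lies over `Spec F`. [folklore] -/
theorem galPt_hom_extHom (σ : F' ≃ₐ[F] F') :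
    (galPt F F' π σ).hom ≫ extHom F F' π = extHom F F' π := by
  ext : 1
  rw [Over.comp_left, galPt_hom_left, extHom_left]
  exact specAut_comp_bcSpec F' σ⁻¹

variable [FiniteDimensional F F'] [IsGalois F F']

omit [IsIntegral C.left] in
/-- **`C^{(d)}` classifies effective divisors split over a Galois extension** (Milne, *Jacobian
Varieties*, Thm. 3.13 at field-valued points, separable case; Weil's "fundamental theorem on
symmetric functions", Lang, *Abelian Varieties*, I §1 p. 8: "obvious in the case where all the
points of `𝔞` are rational over a separable extension of `k`"): if the pullback of `D` to `C_{F'}`,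
`F'/F` finite Galois, is `Σᵢ [Qᵢ]` for `F'`-valued points `Qᵢ` of `C`, then the image of
`(Q₁, …, Q_d)` in `C^{(d)}(F')` is the restriction of an `F`-valued point `w` of `C^{(d)}`:
it is `Gal(F'/F)`-invariant (`exists_perm_of_split`, `comp_tuplePt_mk_eq`) and descends
(`exists_fieldPoint_of_gal_invariant`). [cite: Milne1986JacobianVarieties, §3 Thm. 3.13 (T = Spec F) with proof (split case and descent)] -/
theorem exists_fieldPoint_of_split_galois (D : CartierDivisor (curveBC C π).left)
    (Q : Fin d → (Over.mk (extPt F F' π) ⟶ C))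
    (hsplit : toDivisor (curveBC C (extPt F F' π)) (fieldExtPullback C (extHom F F' π) D) =
      ∑ i, Finsupp.single (place (curveBC C (extPt F F' π)) (ratPtPoint C (extPt F F' π) (Q i))
        (ratPtPoint_ne_genericPoint C _ _)) 1) :
    ∃ w : Over.mk π ⟶ symPowProj C hC d,
      extHom F F' π ≫ w = tuplePt C (extPt F F' π) Q ≫ symPowProj.mk C hC d := by
  set y := tuplePt C (extPt F F' π) Q ≫ symPowProj.mk C hC d with hy
  have hinv : ∀ σ : F' ≃ₐ[F] F', specAut F' σ⁻¹ ≫ y.left = y.left := by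
    intro σ
    obtain ⟨ρ, hρ⟩ := exists_perm_of_split C (extHom F F' π) D Q hsplit (galPt F F' π σ).hom
      (galPt_hom_extHom F F' π σ)
    have h := comp_tuplePt_mk_eq C hC (galPt F F' π σ).hom Q ρ hρ
    have h' := congrArg CommaMorphism.left h
    exact h'
  obtain ⟨w, hw⟩ := exists_fieldPoint_of_gal_invariant C hC d F F' π y.left (Over.w y) hinv
  refine ⟨w, ?_⟩
  ext : 1
  rw [Over.comp_left, extHom_left]
  exact hw

end SplitGalois

end Literature.AlgebraicGeometry.Motives
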